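import Literature.NumberTheory.EllipticCurves.PAdicLFunctionInterpolationProofs
import HarnessLib

/-!
# The involution `x ↦ -1/(Nx)` of `ℤ_p^×` in the coordinates `x = η γ^s` of the Riemann sums

Topic `NumberTheory/EllipticCurves` (the `p`-adic `L`-function of item C19,
`Literature.NumberTheory.EllipticCurves.padicLFunction`). Second layer of the proof of the
functional equation of `L_p(f, α, T)` (Mazur–Tate–Teitelbaum 1986, §I.17; Greenberg, LNM 1716,
§1, pp. 67–68): pure finite group theory on `(ℤ/p^{n+e₀})^×`, parametrised — as in the Riemann
sums `padicLRiemannSum` of `PAdicLFunction` and in `PAdicLFunctionInterpolationProofs` — by the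
Teichmüller representatives `η ∈ μ_τ(ℤ_p)` and the exponents `s mod p^n` of the topological
generator `γ = 1 + p^{e₀}` through the class `η γ^s mod p^{n+e₀}`.

* `neg_one_mem_rootsOfUnity_torsionOrder`: `-1 ∈ μ_τ(ℤ_p)` (`τ = φ(p^{e₀})` is even), so that
  `⟨-1⟩ = 1`: the involution does not move the `γ`-exponent by a half-integer.
* `classMap_mul`, `classMap_one`, `classMap_neg_one`: `(η, s) ↦ η γ^s` is multiplicative.
* `castHom_classMap_succ`: reduction from level `n + 1` to level `n` reduces the exponent.
* `exists_classMap_eq_of_isUnit`, `exists_classMap_eq_natCast`: every unit, in particular the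
  level `N` prime to `p`, is a class `η γ^s`.
* `exists_teichmuller_exponent_natCast`: **the `p`-adic exponent of `N`** — there are
  `η_N ∈ μ_τ` and `c ∈ ℤ_p` with `N ≡ η_N γ^{c mod p^n} (mod p^{n+e₀})` for every `n`, i.e.
  `N = η_N γ^c`, `⟨N⟩ = γ^c` (Greenberg's `⟨N_E⟩`, with `c = log_p⟨N⟩/log_p γ`); `c` is the
  `p`-adic limit of the compatible discrete logarithms (Mathlib `PadicInt.ofIntSeq`).
* `finsum_sum_classes_eq_mul_of_symmetry`: **reindexing a Riemann sum along the involution**: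
  if a weight `w` on `ℤ/p^{n+e₀}` satisfies `w(u) = σ w(u')` whenever `N u u' = -1`, and
  `N ≡ η_N γ^{s_N}`, then for every `g`,
  `∑_{η, s} w(η γ^s) g(s) = σ ∑_{η, s} w(η γ^s) g(-s_N - s)`,
  because `u = η γ^s ↦ u' = (-η_N⁻¹ η⁻¹) γ^{-s_N - s}` is an involution of the index set with
  `N u u' = -1`. Applied to `w = μ_{f,α}` (`msdMeasure_eq_mul_of_isFrickeEigen`,
  `PAdicLFunctionFrickeSymmetryProofs`) this is the change of variables `x ↦ -1/(Nx)` in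
  `∫_{ℤ_p^×} (·) dμ_{f,α}` of Mazur–Tate–Teitelbaum 1986, §I.17.

## References

* B. Mazur, J. Tate, J. Teitelbaum, *On `p`-adic analogues of the conjectures of Birch and
  Swinnerton-Dyer*, Invent. Math. 84 (1986), 1–48, §I.13 (the coordinates), §I.17.
* R. Greenberg, *Iwasawa theory for elliptic curves*, LNM 1716 (1999), §1, pp. 67–68
  (`⟨N_E⟩`, the projection of `N_E` to `1 + 2pℤ_p`).
* L. C. Washington, *Introduction to cyclotomic fields*, GTM 83, §5.1, §7.2.
-/

noncomputable section

namespace Literature.NumberTheory.EllipticCurves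

variable (p : ℕ) [Fact p.Prime]

/-! ### `-1` is a Teichmüller representative -/

/-- `τ = φ(p^{e₀})` (`= p - 1` for odd `p`, `= 2` for `p = 2`) is even. [folklore] -/
theorem even_torsionOrder : Even (torsionOrder p) := by
  rw [torsionOrder_eq]
  split_ifs with h
  · exact even_two
  · exact (Fact.out : p.Prime).even_sub_one h

/-- **`-1 ∈ μ_τ(ℤ_p)`**: `-1` is a root of unity of order dividing `τ`, i.e. a Teichmüller
representative (`ω(-1) = -1`, `⟨-1⟩ = 1`; Washington §5.1). [folklore] -/
theorem neg_one_mem_rootsOfUnity_torsionOrder :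
    (-1 : ℤ_[p]ˣ) ∈ rootsOfUnity (torsionOrder p) ℤ_[p] := by
  rw [mem_rootsOfUnity]
  exact (even_torsionOrder p).neg_one_pow

/-! ### `(η, s) ↦ η γ^s mod p^{n+e₀}` is multiplicative -/

/-- **Multiplicativity of the classes**: `(η η') γ^{s + s'} = (η γ^s)(η' γ^{s'})` modulo
`p^{n+e₀}` (the exponent of `γ` only matters modulo its order `p^n`,
`orderOf_cyclotomicGenerator`). [folklore] -/
theorem classMap_mul (n : ℕ) (η η' : rootsOfUnity (torsionOrder p) ℤ_[p])
    (s s' : ZMod (p ^ n)) :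
    PadicInt.toZModPow (n + cyclotomicExponent p) (((η * η' : rootsOfUnity (torsionOrder p) ℤ_[p]) :
        ℤ_[p]ˣ) : ℤ_[p]) *
        (cyclotomicGenerator p : ZMod (p ^ (n + cyclotomicExponent p))) ^ (s + s').val =
      (PadicInt.toZModPow (n + cyclotomicExponent p) ((η : ℤ_[p]ˣ) : ℤ_[p]) *
          (cyclotomicGenerator p : ZMod (p ^ (n + cyclotomicExponent p))) ^ s.val) *
        (PadicInt.toZModPow (n + cyclotomicExponent p) ((η' : ℤ_[p]ˣ) : ℤ_[p]) *
          (cyclotomicGenerator p : ZMod (p ^ (n + cyclotomicExponent p))) ^ s'.val) := by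
  haveI : NeZero (p ^ n) := ⟨pow_ne_zero _ (Fact.out : p.Prime).ne_zero⟩
  have hpow : (cyclotomicGenerator p : ZMod (p ^ (n + cyclotomicExponent p))) ^
      ((s.val + s'.val) % p ^ n) =
      (cyclotomicGenerator p : ZMod (p ^ (n + cyclotomicExponent p))) ^ (s.val + s'.val) := by
    have h := pow_mod_orderOf (cyclotomicGenerator p : ZMod (p ^ (n + cyclotomicExponent p)))
      (s.val + s'.val)
    rwa [orderOf_cyclotomicGenerator p n] at h
  rw [Subgroup.coe_mul, Units.val_mul, map_mul, ZMod.val_add, hpow,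
    pow_add (cyclotomicGenerator p : ZMod (p ^ (n + cyclotomicExponent p))) s.val s'.val]
  ring

/-- The class of `(1, 0)` is `1`. [folklore] -/
theorem classMap_one (n : ℕ) :
    PadicInt.toZModPow (n + cyclotomicExponent p)
        (((1 : rootsOfUnity (torsionOrder p) ℤ_[p]) : ℤ_[p]ˣ) : ℤ_[p]) *
        (cyclotomicGenerator p : ZMod (p ^ (n + cyclotomicExponent p))) ^ (0 : ZMod (p ^ n)).val =
      1 := by
  rw [Subgroup.coe_one, Units.val_one, map_one, ZMod.val_zero, pow_zero, mul_one]

/-- The class of `(-1, 0)` is `-1`. [folklore] -/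
theorem classMap_neg_one (n : ℕ) :
    PadicInt.toZModPow (n + cyclotomicExponent p)
        (((⟨-1, neg_one_mem_rootsOfUnity_torsionOrder p⟩ : rootsOfUnity (torsionOrder p) ℤ_[p]) :
          ℤ_[p]ˣ) : ℤ_[p]) *
        (cyclotomicGenerator p : ZMod (p ^ (n + cyclotomicExponent p))) ^ (0 : ZMod (p ^ n)).val =
      -1 := by
  rw [ZMod.val_zero, pow_zero, mul_one]
  change PadicInt.toZModPow (n + cyclotomicExponent p) (((-1 : ℤ_[p]ˣ)) : ℤ_[p]) = -1
  rw [Units.val_neg, Units.val_one, map_neg, map_one]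

/-- **Reduction by one level reduces the exponent**: the class `η γ^{s'} mod p^{n+1+e₀}`
(`s' mod p^{n+1}`) reduces modulo `p^{n+e₀}` to the class `η γ^{s' mod p^n}`. [folklore] -/
theorem castHom_classMap_succ (n : ℕ) (η : rootsOfUnity (torsionOrder p) ℤ_[p])
    (s : ZMod (p ^ (n + 1))) :
    ZMod.castHom (pow_dvd_pow p (show n + cyclotomicExponent p ≤ n + 1 + cyclotomicExponent p by
        omega)) (ZMod (p ^ (n + cyclotomicExponent p)))
        (PadicInt.toZModPow (n + 1 + cyclotomicExponent p) ((η : ℤ_[p]ˣ) : ℤ_[p]) *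
          (cyclotomicGenerator p : ZMod (p ^ (n + 1 + cyclotomicExponent p))) ^ s.val) =
      PadicInt.toZModPow (n + cyclotomicExponent p) ((η : ℤ_[p]ˣ) : ℤ_[p]) *
        (cyclotomicGenerator p : ZMod (p ^ (n + cyclotomicExponent p))) ^
          ((s.val : ZMod (p ^ n))).val := by
  have hle : n + cyclotomicExponent p ≤ n + 1 + cyclotomicExponent p := by omega
  have hpow : (cyclotomicGenerator p : ZMod (p ^ (n + cyclotomicExponent p))) ^ (s.val % p ^ n) =
      (cyclotomicGenerator p : ZMod (p ^ (n + cyclotomicExponent p))) ^ s.val := by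
    have h := pow_mod_orderOf (cyclotomicGenerator p : ZMod (p ^ (n + cyclotomicExponent p))) s.val
    rwa [orderOf_cyclotomicGenerator p n] at h
  rw [map_mul, map_pow, map_natCast, ZMod.castHom_apply, PadicInt.cast_toZModPow _ _ hle,
    ZMod.val_natCast, hpow]

/-! ### Every unit is a class; the Teichmüller part and the exponent of `N` -/

/-- **Every unit modulo `p^{n+e₀}` is a class `η γ^s`** (`(η, s) ↦ η γ^s` is a bijection
`μ_τ × ℤ/p^n → (ℤ/p^{n+e₀})^×`: injective between finite sets of the same cardinality,
`classMap_injective`, `card_classDomain`; Washington §7.2). [folklore] -/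
theorem exists_classMap_eq_of_isUnit (n : ℕ) {u : ZMod (p ^ (n + cyclotomicExponent p))}
    (hu : IsUnit u) :
    ∃ (η : rootsOfUnity (torsionOrder p) ℤ_[p]) (s : ZMod (p ^ n)),
      PadicInt.toZModPow (n + cyclotomicExponent p) ((η : ℤ_[p]ˣ) : ℤ_[p]) *
        (cyclotomicGenerator p : ZMod (p ^ (n + cyclotomicExponent p))) ^ s.val = u := by
  classical
  haveI := neZero_torsionOrder p
  haveI := Fintype.ofFinite (rootsOfUnity (torsionOrder p) ℤ_[p])
  set Φ : rootsOfUnity (torsionOrder p) ℤ_[p] × ZMod (p ^ n) →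
      (ZMod (p ^ (n + cyclotomicExponent p)))ˣ := fun x ↦ (isUnit_classMap p n x).unit with hΦ
  have hΦval : ∀ x, (Φ x : ZMod (p ^ (n + cyclotomicExponent p))) =
      PadicInt.toZModPow (n + cyclotomicExponent p) ((x.1 : ℤ_[p]ˣ) : ℤ_[p]) *
        (cyclotomicGenerator p : ZMod (p ^ (n + cyclotomicExponent p))) ^ x.2.val :=
    fun x ↦ IsUnit.unit_spec _
  have hΦinj : Function.Injective Φ := fun x y hxy ↦ classMap_injective p n (by
    have h := congr_arg Units.val hxy
    rwa [hΦval, hΦval] at h)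
  have hΦbij : Function.Bijective Φ :=
    (Fintype.bijective_iff_injective_and_card Φ).mpr ⟨hΦinj, card_classDomain p n⟩
  obtain ⟨⟨η, s⟩, hx⟩ := hΦbij.2 hu.unit
  refine ⟨η, s, ?_⟩
  rw [← hΦval (η, s), hx, IsUnit.unit_spec]

/-- A natural number `N` prime to `p` is a class `η γ^s` modulo `p^{n+e₀}`, for every `n`.
[folklore] -/
theorem exists_classMap_eq_natCast (n : ℕ) {N : ℕ} (hpN : ¬ p ∣ N) :
    ∃ (η : rootsOfUnity (torsionOrder p) ℤ_[p]) (s : ZMod (p ^ n)),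
      PadicInt.toZModPow (n + cyclotomicExponent p) ((η : ℤ_[p]ˣ) : ℤ_[p]) *
        (cyclotomicGenerator p : ZMod (p ^ (n + cyclotomicExponent p))) ^ s.val =
          (N : ZMod (p ^ (n + cyclotomicExponent p))) := by
  refine exists_classMap_eq_of_isUnit p n ?_
  have hcop : N.Coprime (p ^ (n + cyclotomicExponent p)) :=
    Nat.Coprime.pow_right _ (((Fact.out : p.Prime).coprime_iff_not_dvd).mpr hpN).symm
  rw [← ZMod.coe_unitOfCoprime N hcop]
  exact Units.isUnit _

/-- **The Teichmüller part and the `p`-adic exponent of `N`.** For `N` prime to `p` there are a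
root of unity `η_N ∈ μ_τ(ℤ_p)` and a `p`-adic integer `c` such that, for every `n`,
`N ≡ η_N γ^{c mod p^n} (mod p^{n+e₀})`; that is `N = ω(N) ⟨N⟩` with `⟨N⟩ = γ^c`,
`c = log_p⟨N⟩ / log_p γ` — the exponent in Greenberg's `⟨N_E⟩^{s-1} = (κ(γ)^{s-1})^c`
(Greenberg, LNM 1716, §1, p. 68: "`⟨N_E⟩` is the projection of `N_E` to `1 + 2pℤ_p`"). The
discrete logarithms `s_n` of `N` at the finite levels (`exists_classMap_eq_natCast`) have a common
Teichmüller part (reduce modulo `p^{e₀}`, `toZModPow_rootsOfUnity_injective`) and are compatible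
(`castHom_classMap_succ`, `classMap_injective`), and `c` is their `p`-adic limit (Mathlib
`PadicInt.ofIntSeq`, `PadicInt.toZModPow_ofIntSeq_of_pow_dvd_sub`).
[cite: GreenbergLNM1716, §1 (p. 68, ⟨N_E⟩)] -/
theorem exists_teichmuller_exponent_natCast {N : ℕ} (hpN : ¬ p ∣ N) :
    ∃ (ηN : rootsOfUnity (torsionOrder p) ℤ_[p]) (c : ℤ_[p]), ∀ n : ℕ,
      PadicInt.toZModPow (n + cyclotomicExponent p) ((ηN : ℤ_[p]ˣ) : ℤ_[p]) *
        (cyclotomicGenerator p : ZMod (p ^ (n + cyclotomicExponent p))) ^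
          (PadicInt.toZModPow n c).val =
          (N : ZMod (p ^ (n + cyclotomicExponent p))) := by
  choose η s hηs using fun n ↦ exists_classMap_eq_natCast p n hpN
  -- all Teichmüller parts coincide: reduce modulo `p^{e₀}`
  have key : ∀ m, PadicInt.toZModPow (cyclotomicExponent p) ((η m : ℤ_[p]ˣ) : ℤ_[p]) =
      (N : ZMod (p ^ cyclotomicExponent p)) := by
    intro m
    have hle : cyclotomicExponent p ≤ m + cyclotomicExponent p := Nat.le_add_left _ _
    have h := congr_arg (ZMod.castHom (pow_dvd_pow p hle) (ZMod (p ^ cyclotomicExponent p)))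
      (hηs m)
    simp only [map_mul, map_pow, map_natCast, cyclotomicGenerator_cast_cyclotomicExponent,
      one_pow, mul_one, ZMod.castHom_apply, PadicInt.cast_toZModPow _ _ hle] at h
    exact h
  have hη : ∀ n, η n = η 0 := fun n ↦
    toZModPow_rootsOfUnity_injective p (by dsimp only; rw [key n, key 0])
  -- successive compatibility of the exponents
  have hs : ∀ i, (p : ℤ) ^ i ∣ ((s (i + 1)).val : ℤ) - (s i).val := by
    intro i
    haveI : NeZero (p ^ i) := ⟨pow_ne_zero _ (Fact.out : p.Prime).ne_zero⟩
    have hle : i + cyclotomicExponent p ≤ i + 1 + cyclotomicExponent p := by omega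
    have h := congr_arg (ZMod.castHom (pow_dvd_pow p hle) (ZMod (p ^ (i + cyclotomicExponent p))))
      (hηs (i + 1))
    rw [castHom_classMap_succ, map_natCast, hη (i + 1), ← hη i, ← hηs i] at h
    have hinj := classMap_injective p i (a₁ := (η i, ((s (i + 1)).val : ZMod (p ^ i))))
      (a₂ := (η i, s i)) h
    have h2 : ((s (i + 1)).val : ZMod (p ^ i)) = s i := congr_arg Prod.snd hinj
    have h3 : (s i).val ≡ (s (i + 1)).val [MOD p ^ i] := by
      rw [← ZMod.natCast_eq_natCast_iff, ZMod.natCast_zmod_val]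
      exact h2.symm
    have h4 := Nat.modEq_iff_dvd.mp h3
    push_cast at h4
    exact h4
  refine ⟨η 0, PadicInt.ofIntSeq _
    (PadicInt.isCauSeq_padicNorm_of_pow_dvd_sub (fun i ↦ ((s i).val : ℤ)) p hs), fun n ↦ ?_⟩
  haveI : NeZero (p ^ n) := ⟨pow_ne_zero _ (Fact.out : p.Prime).ne_zero⟩
  rw [PadicInt.toZModPow_ofIntSeq_of_pow_dvd_sub (fun i ↦ ((s i).val : ℤ)) p hs n, Int.cast_natCast,
    ZMod.natCast_zmod_val, ← hη n]
  exact hηs n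

/-- With `c` as in `exists_teichmuller_exponent_natCast`, the exponents `s` and `-c - s` of two
classes in involution add up to `-c` in `ℤ_p` up to `p^n`:
`c + s + (-(c mod p^n) - s) ∈ p^n ℤ_p` (representatives in `[0, p^n)`). This is the congruence
feeding the `p`-adic continuity of `x ↦ (x choose k)` in the functional equation. [folklore] -/
theorem exponent_add_val_add_val_mem_span (c : ℤ_[p]) (n : ℕ) (s : ZMod (p ^ n)) :
    c + (s.val : ℤ_[p]) + ((-PadicInt.toZModPow n c - s).val : ℤ_[p]) ∈
      Ideal.span {(p : ℤ_[p]) ^ n} := by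
  haveI : NeZero (p ^ n) := ⟨pow_ne_zero _ (Fact.out : p.Prime).ne_zero⟩
  rw [← PadicInt.ker_toZModPow, RingHom.mem_ker, map_add, map_add, map_natCast, map_natCast,
    ZMod.natCast_zmod_val, ZMod.natCast_zmod_val]
  ring

/-! ### Reindexing a Riemann sum along the involution -/

/-- **Reindexing along `u ↦ -1/(Nu)`.** Let `w : ℤ/p^{n+e₀} → R` be a weight with
`w(u) = σ w(u')` whenever `ν u u' = -1`, and let `ν = η_N γ^{s_N}` be a class. Then for every
`g : ℤ/p^n → R`,
`∑_{η ∈ μ_τ} ∑_{s mod p^n} w(η γ^s) g(s) = σ ∑_{η} ∑_{s} w(η γ^s) g(-s_N - s)`: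
the map `(η, s) ↦ ((-1) η_N⁻¹ η⁻¹, -s_N - s)` is an involution of `μ_τ × ℤ/p^n` whose classes
`u, u'` satisfy `ν u u' = -1` (`classMap_mul`, `classMap_neg_one`). With `w = μ_{f,α}` on
`ℤ/p^{n+e₀}` (`msdMeasure_eq_mul_of_isFrickeEigen`) and `ν = N` this is the substitution
`x ↦ -1/(Nx)` in the Riemann sums of `∫_{ℤ_p^×} g(ℓ(x)) dμ_{f,α}(x)`, `ℓ(-1/(Nx)) = -ℓ(N) - ℓ(x)`
(Mazur–Tate–Teitelbaum 1986, §I.17). [cite: MazurTateTeitelbaum1986Invent, §I.17] -/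
theorem finsum_sum_classes_eq_mul_of_symmetry {R : Type*} [CommRing R] (n : ℕ) {σ : R}
    {ν : ZMod (p ^ (n + cyclotomicExponent p))} {w : ZMod (p ^ (n + cyclotomicExponent p)) → R}
    (hw : ∀ u u' : ZMod (p ^ (n + cyclotomicExponent p)), ν * u * u' = -1 → w u = σ * w u')
    {ηN : rootsOfUnity (torsionOrder p) ℤ_[p]} {sN : ZMod (p ^ n)}
    (hν : PadicInt.toZModPow (n + cyclotomicExponent p) ((ηN : ℤ_[p]ˣ) : ℤ_[p]) *
        (cyclotomicGenerator p : ZMod (p ^ (n + cyclotomicExponent p))) ^ sN.val = ν)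
    (g : ZMod (p ^ n) → R) :
    ∑ᶠ η : rootsOfUnity (torsionOrder p) ℤ_[p], ∑ s : ZMod (p ^ n),
        w (PadicInt.toZModPow (n + cyclotomicExponent p) ((η : ℤ_[p]ˣ) : ℤ_[p]) *
          (cyclotomicGenerator p : ZMod (p ^ (n + cyclotomicExponent p))) ^ s.val) * g s =
      σ * ∑ᶠ η : rootsOfUnity (torsionOrder p) ℤ_[p], ∑ s : ZMod (p ^ n),
        w (PadicInt.toZModPow (n + cyclotomicExponent p) ((η : ℤ_[p]ˣ) : ℤ_[p]) *
          (cyclotomicGenerator p : ZMod (p ^ (n + cyclotomicExponent p))) ^ s.val) *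
            g (-sN - s) := by
  classical
  haveI := neZero_torsionOrder p
  haveI := Fintype.ofFinite (rootsOfUnity (torsionOrder p) ℤ_[p])
  haveI : NeZero (p ^ n) := ⟨pow_ne_zero _ (Fact.out : p.Prime).ne_zero⟩
  set m1 : rootsOfUnity (torsionOrder p) ℤ_[p] := ⟨-1, neg_one_mem_rootsOfUnity_torsionOrder p⟩
    with hm1
  -- the classes, as a function of the pair
  set Φ : rootsOfUnity (torsionOrder p) ℤ_[p] × ZMod (p ^ n) →
      ZMod (p ^ (n + cyclotomicExponent p)) := fun x ↦
    PadicInt.toZModPow (n + cyclotomicExponent p) ((x.1 : ℤ_[p]ˣ) : ℤ_[p]) *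
      (cyclotomicGenerator p : ZMod (p ^ (n + cyclotomicExponent p))) ^ x.2.val with hΦ
  have hΦmul : ∀ x y : rootsOfUnity (torsionOrder p) ℤ_[p] × ZMod (p ^ n),
      Φ (x.1 * y.1, x.2 + y.2) = Φ x * Φ y := fun x y ↦ classMap_mul p n x.1 y.1 x.2 y.2
  -- the involution
  set ι : rootsOfUnity (torsionOrder p) ℤ_[p] × ZMod (p ^ n) →
      rootsOfUnity (torsionOrder p) ℤ_[p] × ZMod (p ^ n) := fun x ↦ (m1 / ηN / x.1, -sN - x.2)
    with hι
  have hιι : Function.Involutive ι := by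
    intro x
    simp only [hι]
    ext1
    · dsimp only
      rw [div_div_cancel]
    · dsimp only
      rw [sub_sub_cancel]
  -- `ν Φ(x) Φ(ι x) = -1`
  have hkey : ∀ x : rootsOfUnity (torsionOrder p) ℤ_[p] × ZMod (p ^ n),
      ν * Φ x * Φ (ι x) = -1 := by
    intro x
    have h1 : ν = Φ (ηN, sN) := hν.symm
    have h2 : (ηN * x.1 * (m1 / ηN / x.1), sN + x.2 + (-sN - x.2)) = (m1, (0 : ZMod (p ^ n))) := by
      ext1
      · dsimp only
        rw [mul_comm, div_div, div_mul_cancel]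
      · dsimp only
        ring
    rw [h1, ← hΦmul, ← hΦmul]
    simp only [hι]
    rw [h2]
    exact classMap_neg_one p n
  -- the sums over the pairs
  rw [finsum_eq_sum_of_fintype, finsum_eq_sum_of_fintype, ← Fintype.sum_prod_type',
    ← Fintype.sum_prod_type', Finset.mul_sum]
  change ∑ x, w (Φ x) * g x.2 = ∑ x, σ * (w (Φ x) * g (-sN - x.2))
  have step : ∀ x : rootsOfUnity (torsionOrder p) ℤ_[p] × ZMod (p ^ n),
      w (Φ x) * g x.2 = σ * (w (Φ (ι x)) * g (-sN - (ι x).2)) := by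
    intro x
    rw [hw _ _ (hkey x)]
    have hx2 : -sN - (ι x).2 = x.2 := by simp only [hι]; rw [sub_sub_cancel]
    rw [hx2, mul_assoc]
  rw [Fintype.sum_congr _ _ step]
  exact Fintype.sum_bijective ι hιι.bijective _ _ fun x ↦ rfl

end Literature.NumberTheory.EllipticCurves

end
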